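import Mathlib
import Summits.AnomalousDissipation.AnomalousDissipation.Theses.MarginalStabilityChain
import Summits.AnomalousDissipation.AnomalousDissipation.Theses.TwoAndHalfD

/-!
# Crux idea `generic-point-eternalisation` — first lemmas (ideator 1, round 1, crux stmt-AnomalousDissipation-3005)

(1) `budget_selection` — PROVED: the two-budget Markov/Cauchy–Schwarz selection over a probability
    measure (the abstract heart of "a loud invariant measure on smooth eternal solutions has a point whose
    trajectory meets BOTH budgets").
(2) `ForwardRegularLoudFamily` (= C⁺), `EternalisationAt ν f` (the single-viscosity eternalisation lemma,
    stated), and the kernel-checked composition `chainThesis_of_eternalisation : (∀ ν f, …) → C⁺ → ChainThesis`.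
(3) `forwardRegular_of_twohalfd` (stated): the unconditional 2½-D feed TwohalfdThesis (0206) → C⁺.
-/

noncomputable section

namespace Summit.AnomalousDissipation.AnomalousDissipation.Cruxes.ChainThesis.GenericPointEternalisation

open MeasureTheory Filter Set
open Literature.Analysis.FunctionSpaces Literature.Analysis.FluidPDE

local notation "𝕋³" => UnitAddTorus (Fin 3)
local notation "E³" => EuclideanSpace ℝ (Fin 3)

/-! ## (1) The budget-selection lemma (proved) -/

/-- Pointwise step: if a point violates the selection, its dissipation is affinely dominated by its energy. -/
theorem pointwise_bound {D K F E ε : ℝ} (hε : 0 < ε) (hF : 0 < F) (hE : 0 < E)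
    (hK0 : 0 ≤ K) (hDK : D ≤ F * Real.sqrt K)
    (h : ε / 2 ≤ D → (4 * F * E / ε) ^ 2 < K) :
    D ≤ ε / 2 + ε / (4 * E) * K := by
  by_cases hD : ε / 2 ≤ D
  · have hKB : (4 * F * E / ε) ^ 2 < K := h hD
    have hs0 : 0 < 4 * F * E / ε := by positivity
    have hsqrtK : 4 * F * E / ε ≤ Real.sqrt K := by
      rw [← Real.sqrt_sq hs0.le]
      exact Real.sqrt_le_sqrt hKB.le
    have hsK : 0 ≤ Real.sqrt K := Real.sqrt_nonneg K
    have h2 : F ≤ ε / (4 * E) * Real.sqrt K := by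
      calc F = ε / (4 * E) * (4 * F * E / ε) := by field_simp
        _ ≤ ε / (4 * E) * Real.sqrt K := by
            apply mul_le_mul_of_nonneg_left hsqrtK; positivity
    have h1 : F * Real.sqrt K ≤ ε / (4 * E) * K := by
      calc F * Real.sqrt K ≤ (ε / (4 * E) * Real.sqrt K) * Real.sqrt K :=
            mul_le_mul_of_nonneg_right h2 hsK
        _ = ε / (4 * E) * (Real.sqrt K * Real.sqrt K) := by ring
        _ = ε / (4 * E) * K := by rw [Real.mul_self_sqrt hK0]
    have : 0 ≤ ε / 2 := by positivity
    linarith [hDK, h1]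
  · push Not at hD
    have : 0 ≤ ε / (4 * E) * K := by positivity
    linarith

/-- **Budget selection.** On a probability space, if `0 ≤ D ≤ F·√K` pointwise, `∫ D ≥ ε > 0` and
`∫ K ≤ E`, then some point has `D ≥ ε/2` AND `K ≤ (4FE/ε)²`. (Applied with μ an invariant measure on a
compact set of smooth eternal Navier–Stokes solutions, `D` = Birkhoff limit of the dissipation = of the
injection `(f,u)`, `K` = Birkhoff limit of the energy, `F = ‖f‖₂`.) -/
theorem budget_selection {X : Type*} [MeasurableSpace X] {μ : Measure X} [IsProbabilityMeasure μ]
    {D K : X → ℝ} {F E ε : ℝ} (hε : 0 < ε) (hF : 0 < F) (hE : 0 < E)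
    (hD0 : ∀ x, 0 ≤ D x) (hK0 : ∀ x, 0 ≤ K x)
    (hDm : AEStronglyMeasurable D μ) (hKi : Integrable K μ)
    (hDK : ∀ x, D x ≤ F * Real.sqrt (K x))
    (hDmean : ε ≤ ∫ x, D x ∂μ) (hKmean : ∫ x, K x ∂μ ≤ E) :
    ∃ x, ε / 2 ≤ D x ∧ K x ≤ (4 * F * E / ε) ^ 2 := by
  by_contra hcon
  push Not at hcon
  have hpt : ∀ x, D x ≤ ε / 2 + ε / (4 * E) * K x := fun x =>
    pointwise_bound hε hF hE (hK0 x) (hDK x) (hcon x)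
  have hGi : Integrable (fun x => ε / 2 + ε / (4 * E) * K x) μ :=
    (integrable_const _).add (hKi.const_mul _)
  have hDi : Integrable D μ := by
    refine Integrable.mono' hGi hDm ?_
    filter_upwards with x
    rw [Real.norm_eq_abs, abs_of_nonneg (hD0 x)]
    exact hpt x
  have hint : ∫ x, D x ∂μ ≤ ∫ x, (ε / 2 + ε / (4 * E) * K x) ∂μ :=
    integral_mono hDi hGi hpt
  have hcalc : ∫ x, (ε / 2 + ε / (4 * E) * K x) ∂μ = ε / 2 + ε / (4 * E) * ∫ x, K x ∂μ := by
    rw [integral_add (integrable_const _) (hKi.const_mul _), integral_const, integral_const_mul]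
    simp
  have h4 : ε / (4 * E) * ∫ x, K x ∂μ ≤ ε / 4 := by
    calc ε / (4 * E) * ∫ x, K x ∂μ ≤ ε / (4 * E) * E := by
          apply mul_le_mul_of_nonneg_left hKmean; positivity
      _ = ε / 4 := by field_simp
  linarith

/-! ## (2) The transfer C⁺ → ChainThesis, modulo the single-viscosity eternalisation lemma -/

/-- **C⁺ = forward-regular loud family**: ONE steady smooth force, `ν_j → 0`, classical solutions on
`[0, ∞) × T³` (any smooth data) whose enstrophy is bounded on `t ≥ 1` (a `j`-dependent bound suffices),
bounded limsup-mean energy and limsup-mean dissipation `≥ ε`. Nothing is asked for `t < 0`. -/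
def ForwardRegularLoudFamily : Prop :=
  ∃ f : 𝕋³ → E³, Torus.IsSmooth f ∧ Torus.IsDivFree f ∧ Torus.HasZeroMean f ∧
    ∃ (ν : ℕ → ℝ) (u : ℕ → ℝ → 𝕋³ → E³) (p : ℕ → ℝ → 𝕋³ → ℝ),
      (∀ j, 0 < ν j) ∧ Tendsto ν atTop (nhds 0) ∧
      (∀ j, Torus.IsClassicalNSSolutionOn (Set.Ici 0) (ν j) (fun _ => f) (u j) (p j)) ∧
      (∀ j, ∃ M : ℝ, ∀ t : ℝ, 1 ≤ t → Torus.gradNormSq (u j t) ≤ M) ∧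
      (∃ E : ℝ, ∀ j, meanEnergy (u j) ≤ E) ∧
      ∃ ε : ℝ, 0 < ε ∧ ∀ j, ε ≤ meanDissipation (ν j) (u j)

/-- **Eternalisation at one viscosity** (the lemma of the card; size M): a forward classical solution with
eventually bounded enstrophy and good limsup budgets yields an ETERNAL classical solution of the same
system (a generic point of a loud invariant measure on the smooth ω-limit set) with dissipation `≥ ε/2` and
energy `≤ 16‖f‖₂²·max(E,1)²/ε²`. Ingredients: fixed-ν parabolic regularity (H¹-bounded forward orbit ⇒
precompact in every Cᵏ; limit points generate complete smooth solutions), Krylov–Bogoliubov on the compact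
ω-limit set along times realising the limsup of the dissipation means, Birkhoff (tree:
`Literature.Dynamics.Ergodic.birkhoff_ergodic_theorem_holds`), energy EQUALITY on smooth solutions
(`D* = I* ≤ ‖f‖₂ √K*`), and `budget_selection`. -/
def EternalisationAt (ν : ℝ) (f : 𝕋³ → E³) : Prop :=
  ∀ (u : ℝ → 𝕋³ → E³) (p : ℝ → 𝕋³ → ℝ) (E ε : ℝ),
    Torus.IsClassicalNSSolutionOn (Set.Ici 0) ν (fun _ => f) u p →
    (∃ M : ℝ, ∀ t : ℝ, 1 ≤ t → Torus.gradNormSq (u t) ≤ M) →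
    meanEnergy u ≤ E → 0 < ε → ε ≤ meanDissipation ν u →
    ∃ (v : ℝ → 𝕋³ → E³) (q : ℝ → 𝕋³ → ℝ),
      Torus.IsClassicalNSSolutionOn Set.univ ν (fun _ => f) v q ∧
      meanEnergy v ≤ 16 * (∫ x, ‖f x‖ ^ 2) * (max E 1) ^ 2 / ε ^ 2 ∧
      ε / 2 ≤ meanDissipation ν v

/-- **Composition (kernel-checked): eternalisation at every viscosity + C⁺ ⇒ the crux BY NAME.** -/
theorem chainThesis_of_eternalisation
    (hEt : ∀ (ν : ℝ) (f : 𝕋³ → E³), 0 < ν → Torus.IsSmooth f → EternalisationAt ν f)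
    (hC : ForwardRegularLoudFamily) :
    Theses.MarginalStabilityChain.ChainThesis := by
  obtain ⟨f, hf, hdiv, hmean, ν, u, p, hν, hν0, hsol, hM, ⟨E, hE⟩, ε, hε, hεle⟩ := hC
  have key : ∀ j, ∃ (v : ℝ → 𝕋³ → E³) (q : ℝ → 𝕋³ → ℝ),
      Torus.IsClassicalNSSolutionOn Set.univ (ν j) (fun _ => f) v q ∧
      meanEnergy v ≤ 16 * (∫ x, ‖f x‖ ^ 2) * (max E 1) ^ 2 / ε ^ 2 ∧
      ε / 2 ≤ meanDissipation (ν j) v :=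
    fun j => hEt (ν j) f (hν j) hf (u j) (p j) E ε (hsol j) (hM j) (hE j) hε (hεle j)
  choose v q hv using key
  exact ⟨f, hf, hdiv, hmean, ν, v, q, hν, hν0, fun j => (hv j).1, ⟨_, fun j => (hv j).2.1⟩, ε / 2,
    by positivity, fun j => (hv j).2.2⟩

/-! ## (3) The unconditional 2½-D feed (stated) -/

/-- **2½-D feed** (stated; size M, all 2-D): an `x₃`-invariant global Leray–Hopf family (route TwoAndHalfD's
target `TwohalfdThesis`, stmt-0206) is, after the time shift `t ↦ t + 1` (limsup-Cesàro means are shift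
invariant), a forward-regular family: 2-D Navier–Stokes + a passive scalar with smooth steady source are
uniquely solvable, smooth for `t > 0` and bounded in every `Hᵐ` on `t ≥ 1` at fixed `ν`. -/
theorem forwardRegular_of_twohalfd :
    Theses.TwoAndHalfD.TwohalfdThesis → ForwardRegularLoudFamily := by
  sorry

/-- Hence, modulo the two stated lemmas, **TwohalfdThesis (0206) ⇒ ChainThesis (3005)** — one proof, two routes. -/
theorem chainThesis_of_twohalfd
    (hEt : ∀ (ν : ℝ) (f : 𝕋³ → E³), 0 < ν → Torus.IsSmooth f → EternalisationAt ν f)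
    (h : Theses.TwoAndHalfD.TwohalfdThesis) :
    Theses.MarginalStabilityChain.ChainThesis :=
  chainThesis_of_eternalisation hEt (forwardRegular_of_twohalfd h)

end Summit.AnomalousDissipation.AnomalousDissipation.Cruxes.ChainThesis.GenericPointEternalisation

end
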